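import Mathlib
import HarnessLib
import Literature.MathematicalPhysics.StatisticalMechanics.WeightedNormBounds
import Literature.MathematicalPhysics.StatisticalMechanics.RenormalisationMap
import Literature.MathematicalPhysics.StatisticalMechanics.TorusPolymerBridge

/-!
# Lemma 8.3 (i) of [ABKM19]: `‖K(X)‖_{k,X} ≤ ∏_{Y ∈ 𝒞(X)} ‖K(Y)‖_{k,Y}` for an activity that factors over
# strictly disjoint polymers and weights that factorise over them

For a polymer activity `K` that FACTORS on scale `k` (`K(X₁ ∪ X₂) = K(X₁)K(X₂)` for
`(L^k+1)`-separated `k`-polymers, the tree's `Factorises`), a weight family `w` that factorises over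
such unions ((w3) of Theorem 7.1, `WeightData.weight_union`), and gauges `T_Y` dominated by `T_X` for
`Y ⊆ X`, the Taylor-norm bound of `K` on a polymer `X` is the product of its bounds on the connected
components ([ABKM19] Lemma 8.3 (i), `TayNormLE.prod`):

* `separated_biUnion_left`, `eq_prod_of_factorises`, `eq_prod_weight` — bookkeeping over the components;
* **`tayNormLE_of_factorises`** — `|K(X)|_{T_X, w^X} ≤ ∏_{Y ∈ 𝒞(X)} c_Y` from
  `|K(Y)|_{T_Y, w^Y} ≤ c_Y` on the components.

Everything is proved; no named fact.

## References
* S. Adams, S. Buchholz, R. Kotecký, S. Müller, arXiv:1910.13564, Lemma 8.3 (i) [AdamsBuchholzKoteckyMuller2019].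
-/

noncomputable section

namespace Literature.MathematicalPhysics.StatisticalMechanics.GradientRG

open scoped BigOperators Classical
open Finset
open Literature.MathematicalPhysics.StatisticalMechanics.TorusPolymer (IsPolymer Separated)
open Literature.Barriers.CriticalPhenomena.LongRangePhi4.Polymer (IsConn components)
open Literature.MathematicalPhysics.QuantumFieldTheory

variable {d M : ℕ} [NeZero M]

omit [NeZero M] in
/-- A union is separated from `Z` iff each piece is. [cite: AdamsBuchholzKoteckyMuller2019, Ch. 6.2 (strict disjointness)] -/
theorem separated_biUnion_left {D : ℕ} {𝓒 : Finset (Finset (Fin d → ZMod M))} {Z : Finset (Fin d → ZMod M)}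
    (h : ∀ Y ∈ 𝓒, Separated D Y Z) : Separated D (𝓒.biUnion id) Z := by
  intro x hx z hz
  obtain ⟨Y, hY, hxY⟩ := mem_biUnion.1 hx
  exact h Y hY x hxY z hz

/-- A union of `s`-polymers is an `s`-polymer. [cite: AdamsBuchholzKoteckyMuller2019, Ch. 6.2] -/
theorem isPolymer_biUnion_id {s : ℕ} {𝓒 : Finset (Finset (Fin d → ZMod M))}
    (hpoly : ∀ Y ∈ 𝓒, IsPolymer s Y) : IsPolymer s (𝓒.biUnion id) := by
  intro x hx
  obtain ⟨Y, hY, hxY⟩ := mem_biUnion.1 hx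
  exact (hpoly Y hY x hxY).trans (Finset.subset_biUnion_of_mem id hY)

/-- **Iterated factorisation**: for a finite family `𝓒` of pairwise `(s+1)`-separated `s`-polymers and an
activity factorising on scale `s` with `K(∅) = 1`, `K(⋃𝓒) = ∏_{Y∈𝓒} K(Y)`.
[cite: AdamsBuchholzKoteckyMuller2019, Lemma 8.3 (i) (proof)] -/
theorem eq_prod_of_factorises {s : ℕ} {K : Finset (Fin d → ZMod M) → ((Fin d → ZMod M) → ℝ) → ℂ}
    (hK : Factorises s K) (hK0 : ∀ φ, K ∅ φ = 1) (𝓒 : Finset (Finset (Fin d → ZMod M)))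
    (hpoly : ∀ Y ∈ 𝓒, IsPolymer s Y)
    (hsep : (𝓒 : Set (Finset (Fin d → ZMod M))).Pairwise (Separated (s + 1)))
    (φ : (Fin d → ZMod M) → ℝ) : K (𝓒.biUnion id) φ = ∏ Y ∈ 𝓒, K Y φ := by
  induction 𝓒 using Finset.induction_on with
  | empty => simp [hK0]
  | insert Y 𝓒 hY ih =>
    have hpoly' : ∀ Z ∈ 𝓒, IsPolymer s Z := fun Z hZ => hpoly Z (mem_insert_of_mem hZ)
    have hsep' : (𝓒 : Set (Finset (Fin d → ZMod M))).Pairwise (Separated (s + 1)) :=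
      hsep.mono (by simp)
    have hsepY : Separated (s + 1) Y (𝓒.biUnion id) := by
      refine (separated_biUnion_left fun Z hZ => ?_).symm
      have hne : Z ≠ Y := fun h => hY (h ▸ hZ)
      exact (hsep (mem_coe.2 (mem_insert_of_mem hZ)) (mem_coe.2 (mem_insert_self _ _)) hne)
    rw [biUnion_insert, prod_insert hY, ← ih hpoly' hsep']
    exact hK Y _ (hpoly Y (mem_insert_self _ _)) (isPolymer_biUnion_id hpoly') hsepY φ

/-- **Iterated weight factorisation** ((w3)): `w(⋃𝓒) = ∏_{Y∈𝓒} w(Y)` for pairwise separated polymers,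
from the two-set factorisation. [cite: AdamsBuchholzKoteckyMuller2019, Theorem 7.1 (w3)] -/
theorem eq_prod_weight {s : ℕ} {w : Finset (Fin d → ZMod M) → ((Fin d → ZMod M) → ℝ) → ℝ}
    (hw : ∀ X Y, IsPolymer s X → IsPolymer s Y → Separated (s + 1) X Y → ∀ φ, w (X ∪ Y) φ = w X φ * w Y φ)
    (hw0 : ∀ φ, w ∅ φ = 1) (𝓒 : Finset (Finset (Fin d → ZMod M))) (hpoly : ∀ Y ∈ 𝓒, IsPolymer s Y)
    (hsep : (𝓒 : Set (Finset (Fin d → ZMod M))).Pairwise (Separated (s + 1)))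
    (φ : (Fin d → ZMod M) → ℝ) : w (𝓒.biUnion id) φ = ∏ Y ∈ 𝓒, w Y φ := by
  induction 𝓒 using Finset.induction_on with
  | empty => simp [hw0]
  | insert Y 𝓒 hY ih =>
    have hpoly' : ∀ Z ∈ 𝓒, IsPolymer s Z := fun Z hZ => hpoly Z (mem_insert_of_mem hZ)
    have hsep' : (𝓒 : Set (Finset (Fin d → ZMod M))).Pairwise (Separated (s + 1)) :=
      hsep.mono (by simp)
    have hsepY : Separated (s + 1) Y (𝓒.biUnion id) := by
      refine (separated_biUnion_left fun Z hZ => ?_).symm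
      have hne : Z ≠ Y := fun h => hY (h ▸ hZ)
      exact (hsep (mem_coe.2 (mem_insert_of_mem hZ)) (mem_coe.2 (mem_insert_self _ _)) hne)
    rw [biUnion_insert, prod_insert hY, ← ih hpoly' hsep']
    exact hw Y _ (hpoly Y (mem_insert_self _ _)) (isPolymer_biUnion_id hpoly') hsepY φ

/-- **[ABKM19] Lemma 8.3 (i): `‖K(X)‖_{k,X} ≤ ∏_{Y ∈ 𝒞(X)} ‖K(Y)‖_{k,Y}`.**  For an `s`-polymer `X` on an
odd torus `M = s·t` (`s, t` odd), an activity `K` factorising on scale `s` with `K(∅) = 1`, weights `w`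
factorising over `(s+1)`-separated polymers with `w(∅) = 1`, gauges `T_Y` (for the components `Y`)
dominated by the gauge `T`, and bounds `|K(Y)|_{T_Y, w^Y} ≤ c_Y` (`c_Y ≥ 0`, `K(Y)` local and `C^{r₀}`):
`|K(X)|_{T, w^X} ≤ ∏_{Y ∈ 𝒞(X)} c_Y`. [cite: AdamsBuchholzKoteckyMuller2019, Lemma 8.3 (i)] -/
theorem tayNormLE_of_factorises {s t : ℕ} (hM : M = s * t) (hs : Odd s) (ht : Odd t)
    {V : Type*} [NormedAddCommGroup V] [NormedSpace ℝ V] (T : ((Fin d → ZMod M) → ℝ) →ₗ[ℝ] V)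
    {Vp : Finset (Fin d → ZMod M) → Type*} [∀ Y, NormedAddCommGroup (Vp Y)] [∀ Y, NormedSpace ℝ (Vp Y)]
    (Tp : ∀ Y : Finset (Fin d → ZMod M), ((Fin d → ZMod M) → ℝ) →ₗ[ℝ] Vp Y) {r₀ : ℕ}
    {w : Finset (Fin d → ZMod M) → ((Fin d → ZMod M) → ℝ) → ℝ}
    (hw : ∀ X Y, IsPolymer s X → IsPolymer s Y → Separated (s + 1) X Y → ∀ φ, w (X ∪ Y) φ = w X φ * w Y φ)
    (hw0 : ∀ φ, w ∅ φ = 1)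
    {K : Finset (Fin d → ZMod M) → ((Fin d → ZMod M) → ℝ) → ℂ} (hK : Factorises s K) (hK0 : ∀ φ, K ∅ φ = 1)
    {X : Finset (Fin d → ZMod M)} (hX : IsPolymer s X) {c : Finset (Fin d → ZMod M) → ℝ}
    (hb : ∀ Y ∈ components X, TayNormLE (Tp Y) r₀ (w Y) (K Y) (c Y))
    (hle : ∀ Y ∈ components X, ∀ ξ, ‖Tp Y ξ‖ ≤ ‖T ξ‖)
    (hKd : ∀ Y ∈ components X, ContDiff ℝ r₀ (K Y))
    (hKloc : ∀ Y ∈ components X, IsGaugeLocal (Tp Y) (K Y)) (hc : ∀ Y ∈ components X, 0 ≤ c Y) :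
    TayNormLE T r₀ (w X) (K X) (∏ Y ∈ components X, c Y) := by
  have hMo : Odd M := by rw [hM]; exact hs.mul ht
  have hpoly : ∀ Y ∈ components X, IsPolymer s Y := fun Y hY =>
    (TorusPolymer.IsPolymer.of_mem_components hMo hs hX hY).1
  have hsep := TorusPolymer.pairwise_separated_components hM hs ht hX
  have hXeq : X = (components X).biUnion id :=
    Literature.Barriers.CriticalPhenomena.LongRangePhi4.Polymer.eq_biUnion_components X
  have hKX : K X = fun φ => ∏ Y ∈ components X, K Y φ := by
    funext φ; conv_lhs => rw [hXeq]; exact eq_prod_of_factorises hK hK0 _ hpoly hsep φ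
  have hwX : ∀ φ, ∏ Y ∈ components X, w Y φ ≤ w X φ := fun φ => by
    conv_rhs => rw [hXeq]
    rw [eq_prod_weight hw hw0 _ hpoly hsep φ]
  rw [hKX]
  exact TayNormLE.prod (T := T) (Ti := fun Y => Tp Y) (wi := fun Y => w Y) (Ki := fun Y => K Y)
    (Ci := c) (components X) hb hle hKd hKloc hc hwX

end Literature.MathematicalPhysics.StatisticalMechanics.GradientRG

end
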